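/-
Copyright (c) 2026 the pub-hodgecm-mathlib formalisation cell (harness21).  Prover seat hodgecm-mathlib-B-p14 (g35): road «S3-tree» (LEAD F0P3a-plan (g11) WORD T10-2; architect A-p16 (g28)
census «S3» v3 = DEAL SHEET, acting architect F0P3-p01 (g16)), brick T1 «the `U(3)_v` tree», file T1b-1 = THE DUAL-LATTICE CALCULUS; 2026-09-01.
-/
import Literature.NumberTheory.Automorphic.UnitaryLatticeTreeDefs   -- ★ T1a (B-p14 (g35)): `latt`, `pairing`, `dualLatt`, `IsVertexLattice`, `latticeGraph`, `mapGL`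
import HarnessLib

/-!
# The lattice graph of a hermitian space — II: THE DUAL-LATTICE CALCULUS (`(g·𝒪^N)^♯ = ((σg)ᵀH)⁻¹·𝒪^N = g·G⁻¹·𝒪^N`, `M^♯♯ = M`, the vertex conditions intrinsically,
# `(c·M)^♯ = (σc)⁻¹·M^♯`, the root is self-dual) (Jacobowitz 1962 §4, §7–§8; Serre, *Trees* II.1.1)

Topic `NumberTheory/Automorphic`; namespace `Literature.NumberTheory.Automorphic.UnitaryLatticeTree`.  THEOREMS ONLY (no definition, no instance, no notation, no named fact,
no `sorry`); kernel lane.  Cell `pub/hodgecm-mathlib` (D-0151), crux H413 = `stmt-HodgeConjecture-24833`; road «S3-tree» (census «S3» v3 §1 rulings A-49/A-53), brick **T1** over the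
definitions ★ `UnitaryLatticeTreeDefs` (T1a; rank-`N` sibling of ★ `HermitianLatticeTree*`, `Valued K ℤᵐ⁰` currency).  HONEST LABEL: HC_CM is proved only modulo the 2 remaining named inputs (hLiu418 24832, h413 24833) until rung 0 closes; nothing printed is asserted here (elementary lattice
algebra over a valuation ring); S3 stays a print row until the road's END lands.

* §5 `pairing_eq_dotProduct`, `pairing_mulVec_left∕_right`, **`pairing_mulVec_mulVec`** (`⟨gu, gv⟩_H = ⟨u, v⟩_{(σg)ᵀHg}`: the Gram matrix of `latt g` is ★ `formCongr σ g H`),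
  `pairing_single_single`, `pairing_antidiagonal` (`= ★ B₀ σ N` at `J₀`).
* §6 `mem_latt_iff_of_isUnit` (`x ∈ A·𝒪^N ↔ A⁻¹x ∈ 𝒪^N`), `mulVec_single_mem_latt`, `mulVec_mem_latt`, **`latt_le_stdLattice_iff`**, **`latt_mul_le_latt_iff`**, **`latt_le_latt_iff`**
  (containment of column lattices = integrality of the transition matrix).
* §7 `forall_v_dotProduct_le_one_iff`, `isUnit_det_transpose_map`, `inv_transpose_map_mul_eq`, **`dualLatt_latt_eq`** (`(A·𝒪^N)^♯ = ((σA)ᵀH)⁻¹·𝒪^N`), **`dualLatt_latt`** (`= g·G⁻¹·𝒪^N`).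
* §8 `map_nonsing_inv`, **`dualLatt_dualLatt_latt`** (`M^♯♯ = M`, `H` hermitian, `σ` involutive), **`latt_le_dualLatt_latt_iff`** (`M ≤ M^♯ ↔` Gram integral), `scaleLattice_latt`,
  **`scaleLattice_dualLatt_latt_le_iff`** (`ϖM^♯ ≤ M ↔ ϖ·G⁻¹` integral), **`dualLatt_scaleLattice`**, `dualLatt_stdLattice`, **`dualLatt_stdLattice_eq_self`** (the root is self-dual).

## References
* [BruhatTits1972] F. Bruhat, J. Tits, *Groupes réductifs sur un corps local I*, Publ. Math. IHÉS 41 (1972), §10 (the building of a rank-one group is a tree).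
* [Tits1979] J. Tits, *Reductive groups over local fields*, PSPM 33.1 (1979), §3.3.3 (hyperspecial `K₀ = 𝒢(𝒪)`), §2.4 (quasi-split unitary groups).
* [Serre1980Trees] J.-P. Serre, *Trees* (1980), Ch. II §1.1 (the tree of `SL₂`: lattices, adjacency, distance from a base lattice).
* [Jacobowitz1962] R. Jacobowitz, *Hermitian forms over local fields*, Amer. J. Math. 84 (1962), §4, §7–§8 (Gram matrices, unimodular and `𝔭`-modular hermitian lattices).
* [Omeara1963] O. T. O'Meara, *Introduction to Quadratic Forms* (1963), §82F (primitive vectors, unimodular lattices).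
-/

set_option autoImplicit false

noncomputable section

open scoped Valued WithZero Matrix MatrixGroups

namespace Literature.NumberTheory.Automorphic.UnitaryLatticeTree

open Literature.NumberTheory.Automorphic Literature.NumberTheory.Automorphic.HermitianLattice

variable {K : Type*} [Field K] [Valued K ℤᵐ⁰] {N : ℕ}

/-! ## §5 The pairing in matrix terms; change of basis -/

omit [Valued K ℤᵐ⁰] in
/-- `pairing σ H x y = (σ ∘ x) ⬝ (H y)`. [cite: Jacobowitz1962, §4] -/
theorem pairing_eq_dotProduct (σ : K →+* K) (H : Matrix (Fin N) (Fin N) K) (x y : Fin N → K) :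
    pairing σ H x y = dotProduct (fun i => σ (x i)) (H.mulVec y) := by
  rw [pairing_apply, dotProduct]
  refine Finset.sum_congr rfl fun i _ => ?_
  rw [Matrix.mulVec, dotProduct, Finset.mul_sum]
  exact Finset.sum_congr rfl fun j _ => by ring

omit [Valued K ℤᵐ⁰] in
/-- Change of basis on the left: `pairing σ H (A u) y = pairing σ ((σA)ᵀ H) u y`. [cite: Jacobowitz1962, §4] -/
theorem pairing_mulVec_left (σ : K →+* K) (H A : Matrix (Fin N) (Fin N) K) (u y : Fin N → K) :
    pairing σ H (A.mulVec u) y = pairing σ ((A.map σ)ᵀ * H) u y := by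
  rw [pairing_eq_dotProduct, pairing_eq_dotProduct]
  have hσ : (fun i => σ (A.mulVec u i)) = (A.map σ).mulVec (fun i => σ (u i)) := by
    funext i
    simp only [Matrix.mulVec, dotProduct, map_sum, map_mul, Matrix.map_apply]
  rw [hσ, ← Matrix.mulVec_mulVec]
  conv_rhs => rw [Matrix.dotProduct_mulVec, Matrix.vecMul_transpose]

omit [Valued K ℤᵐ⁰] in
/-- Change of basis on the right: `pairing σ H x (B v) = pairing σ (H B) x v`. [cite: Jacobowitz1962, §4] -/
theorem pairing_mulVec_right (σ : K →+* K) (H B : Matrix (Fin N) (Fin N) K) (x v : Fin N → K) :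
    pairing σ H x (B.mulVec v) = pairing σ (H * B) x v := by
  rw [pairing_eq_dotProduct, pairing_eq_dotProduct, Matrix.mulVec_mulVec]

omit [Valued K ℤᵐ⁰] in
/-- **Change of basis: `pairing σ H (g u) (g v) = pairing σ (formCongr σ g H) u v`** — the Gram matrix of `latt g` is `formCongr σ g H`. [cite: Jacobowitz1962, §4] -/
theorem pairing_mulVec_mulVec (σ : K →+* K) (H : Matrix (Fin N) (Fin N) K) (g : GL (Fin N) K) (u v : Fin N → K) :
    pairing σ H ((g : Matrix (Fin N) (Fin N) K).mulVec u) ((g : Matrix (Fin N) (Fin N) K).mulVec v) = pairing σ (formCongr σ g H) u v := by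
  rw [pairing_mulVec_left, pairing_mulVec_right, formCongr]

omit [Valued K ℤᵐ⁰] in
/-- `pairing σ H (e i) (e j) = H i j`. [cite: Jacobowitz1962, §4] -/
theorem pairing_single_single (σ : K →+* K) (H : Matrix (Fin N) (Fin N) K) (i j : Fin N) :
    pairing σ H (Pi.single i 1) (Pi.single j 1) = H i j := by
  rw [pairing_apply, Finset.sum_eq_single i, Finset.sum_eq_single j]
  · simp
  · intro b _ hb; simp [Pi.single_eq_of_ne hb]
  · intro h; exact absurd (Finset.mem_univ j) h
  · intro b _ hb; simp [Pi.single_eq_of_ne hb]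
  · intro h; exact absurd (Finset.mem_univ i) h

omit [Valued K ℤᵐ⁰] in
/-- At `H = J₀ = antidiag(1,…,1)` the pairing is ★ `B₀ σ N`. [cite: Jacobowitz1962, §4] -/
theorem pairing_antidiagonal (σ : K →+* K) (x y : Fin N → K) : pairing σ ((StdForm.antidiagonal N).over K) x y = B₀ σ N x y := by
  have hJ : ∀ i j : Fin N, (StdForm.antidiagonal N).over K i j = if j = Fin.rev i then (1 : K) else 0 := by
    intro i j
    simp only [StdForm.over, Matrix.map_apply, StdForm.antidiagonal_J_apply]
    split_ifs <;> simp
  rw [pairing_apply, B₀_apply]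
  refine Finset.sum_congr rfl fun i _ => ?_
  rw [Finset.sum_eq_single (Fin.rev i)]
  · rw [hJ, if_pos rfl, mul_one]
  · intro b _ hb; rw [hJ, if_neg hb, mul_zero, zero_mul]
  · intro h; exact absurd (Finset.mem_univ _) h

/-! ## §6 Lattices of invertible matrices: membership, comparison, integrality -/

/-- **Membership in `latt A` for invertible `A`: `x ∈ A·𝒪^N ↔ A⁻¹x ∈ 𝒪^N`.** [cite: Serre1980Trees, II.1.1] -/
theorem mem_latt_iff_of_isUnit {A : Matrix (Fin N) (Fin N) K} (hA : IsUnit A.det) (x : Fin N → K) :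
    x ∈ latt A ↔ A⁻¹.mulVec x ∈ stdLattice K N := by
  rw [latt, Submodule.mem_map]
  constructor
  · rintro ⟨u, hu, rfl⟩
    rw [LinearMap.restrictScalars_apply, Matrix.toLin'_apply, Matrix.mulVec_mulVec, Matrix.nonsing_inv_mul _ hA, Matrix.one_mulVec]
    exact hu
  · intro h
    refine ⟨A⁻¹.mulVec x, h, ?_⟩
    rw [LinearMap.restrictScalars_apply, Matrix.toLin'_apply, Matrix.mulVec_mulVec, Matrix.mul_nonsing_inv _ hA, Matrix.one_mulVec]

/-- The columns of `A` lie in `latt A`. [cite: Serre1980Trees, II.1.1] -/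
theorem mulVec_single_mem_latt (A : Matrix (Fin N) (Fin N) K) (j : Fin N) : A.mulVec (Pi.single j 1) ∈ latt A :=
  Submodule.mem_map.2 ⟨Pi.single j 1, single_mem_stdLattice j, by rw [LinearMap.restrictScalars_apply, Matrix.toLin'_apply]⟩

/-- `A·u ∈ latt A` for `u ∈ 𝒪^N`. [cite: Serre1980Trees, II.1.1] -/
theorem mulVec_mem_latt (A : Matrix (Fin N) (Fin N) K) {u : Fin N → K} (hu : u ∈ stdLattice K N) : A.mulVec u ∈ latt A :=
  Submodule.mem_map.2 ⟨u, hu, by rw [LinearMap.restrictScalars_apply, Matrix.toLin'_apply]⟩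

/-- **`latt B ≤ 𝒪^N` iff `B` is integral.** [cite: Serre1980Trees, II.1.1] -/
theorem latt_le_stdLattice_iff (B : Matrix (Fin N) (Fin N) K) : latt B ≤ stdLattice K N ↔ IsIntMatrix B := by
  constructor
  · intro h i j
    have hcol := h (mulVec_single_mem_latt B j)
    have : B.mulVec (Pi.single j 1) i = B i j := by simp [Matrix.mulVec, dotProduct, Pi.single_apply]
    rw [← this]; exact hcol i
  · intro hB x hx
    obtain ⟨u, hu, rfl⟩ := Submodule.mem_map.1 hx
    rw [LinearMap.restrictScalars_apply, Matrix.toLin'_apply]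
    exact mulVec_mem_stdLattice_of_forall_v_le_one hB hu

/-- **`latt (A B) ≤ latt A` iff `B` is integral** (`A` invertible). [cite: Serre1980Trees, II.1.1] -/
theorem latt_mul_le_latt_iff {A : Matrix (Fin N) (Fin N) K} (hA : IsUnit A.det) (B : Matrix (Fin N) (Fin N) K) :
    latt (A * B) ≤ latt A ↔ IsIntMatrix B := by
  rw [← latt_le_stdLattice_iff]
  constructor
  · intro h x hx
    have hx' : A.mulVec x ∈ latt (A * B) := by
      obtain ⟨u, hu, rfl⟩ := Submodule.mem_map.1 hx
      rw [LinearMap.restrictScalars_apply, Matrix.toLin'_apply, Matrix.mulVec_mulVec]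
      exact mulVec_mem_latt _ hu
    have := (mem_latt_iff_of_isUnit hA _).1 (h hx')
    rwa [Matrix.mulVec_mulVec, Matrix.nonsing_inv_mul _ hA, Matrix.one_mulVec] at this
  · intro h x hx
    obtain ⟨u, hu, rfl⟩ := Submodule.mem_map.1 hx
    rw [LinearMap.restrictScalars_apply, Matrix.toLin'_apply, ← Matrix.mulVec_mulVec]
    exact mulVec_mem_latt _ (h (mulVec_mem_latt _ hu))

/-- **`latt A ≤ latt A′` iff `A′⁻¹ A` is integral** (`A′` invertible). [cite: Serre1980Trees, II.1.1] -/
theorem latt_le_latt_iff {A' : Matrix (Fin N) (Fin N) K} (hA' : IsUnit A'.det) (A : Matrix (Fin N) (Fin N) K) :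
    latt A ≤ latt A' ↔ IsIntMatrix (A'⁻¹ * A) := by
  rw [← latt_mul_le_latt_iff hA', ← Matrix.mul_assoc, Matrix.mul_nonsing_inv _ hA', Matrix.one_mul]

/-! ## §7 The dual lattice of `latt g` is `latt (g · G⁻¹)` -/

/-- An integral vector pairs integrally with `𝒪^N` iff it is integral: `(∀ u ∈ 𝒪^N, |Σ σ(u_i) w_i| ≤ 1) ↔ w ∈ 𝒪^N`. [cite: Omeara1963, §82F] -/
theorem forall_v_dotProduct_le_one_iff (σ : K →+* K) (hvσ : ∀ a, Valued.v (σ a) = Valued.v a) (w : Fin N → K) :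
    (∀ u ∈ stdLattice K N, Valued.v (dotProduct (fun i => σ (u i)) w) ≤ 1) ↔ w ∈ stdLattice K N := by
  constructor
  · intro h i
    have := h (Pi.single i 1) (single_mem_stdLattice i)
    rwa [show (fun j => σ ((Pi.single i (1 : K) : Fin N → K) j)) = Pi.single i 1 from by
        funext j
        by_cases hji : j = i
        · subst hji; rw [Pi.single_eq_same, map_one]
        · rw [Pi.single_eq_of_ne hji, map_zero], single_dotProduct, one_mul] at this
  · intro hw u hu
    rw [dotProduct]
    refine Valuation.map_sum_le _ fun i _ => ?_
    rw [map_mul, hvσ]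
    exact mul_le_one' (hu i) (hw i)

omit [Valued K ℤᵐ⁰] in
/-- `det ((A.map σ)ᵀ)` is a unit when `det A` is. [cite: Jacobowitz1962, §4] -/
theorem isUnit_det_transpose_map (σ : K →+* K) {A : Matrix (Fin N) (Fin N) K} (hA : IsUnit A.det) : IsUnit ((A.map σ)ᵀ).det := by
  rw [Matrix.det_transpose, ← RingHom.mapMatrix_apply, ← RingHom.map_det]; exact hA.map σ

omit [Valued K ℤᵐ⁰] in
/-- `((σA)ᵀ H)⁻¹ = A · ((σA)ᵀ H A)⁻¹` for invertible `A`. [cite: Jacobowitz1962, §4] -/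
theorem inv_transpose_map_mul_eq (σ : K →+* K) (H : Matrix (Fin N) (Fin N) K) {A : Matrix (Fin N) (Fin N) K} (hA : IsUnit A.det) :
    ((A.map σ)ᵀ * H)⁻¹ = A * ((A.map σ)ᵀ * H * A)⁻¹ := by
  rw [Matrix.mul_inv_rev _ A, ← Matrix.mul_assoc, Matrix.mul_nonsing_inv _ hA, Matrix.one_mul]

/-- **THE DUAL OF `latt A` IS `latt ((σA)ᵀ H)⁻¹`** (`A`, `H` invertible, `σ` valuation-preserving): `x ∈ (A𝒪^N)^♯ ⟺ (σA)ᵀ H x ∈ 𝒪^N ⟺ x ∈ ((σA)ᵀH)⁻¹ 𝒪^N`.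
[cite: Jacobowitz1962, §4] [cite: Serre1980Trees, II.1.1] -/
theorem dualLatt_latt_eq (σ : K →+* K) (hvσ : ∀ a, Valued.v (σ a) = Valued.v a) {H : Matrix (Fin N) (Fin N) K} (hH : IsUnit H.det)
    {A : Matrix (Fin N) (Fin N) K} (hA : IsUnit A.det) : dualLatt σ H (latt A) = latt (((A.map σ)ᵀ * H)⁻¹) := by
  have hAH : IsUnit (((A.map σ)ᵀ) * H).det := by rw [Matrix.det_mul]; exact (isUnit_det_transpose_map σ hA).mul hH
  have hB : IsUnit (((A.map σ)ᵀ * H)⁻¹).det := Matrix.isUnit_nonsing_inv_det_iff.2 hAH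
  ext x
  rw [mem_dualLatt, mem_latt_iff_of_isUnit hB, Matrix.nonsing_inv_nonsing_inv _ hAH]
  constructor
  · intro h
    refine (forall_v_dotProduct_le_one_iff σ hvσ _).1 fun u hu => ?_
    have := h _ (mulVec_mem_latt A hu)
    rwa [pairing_mulVec_left, pairing_eq_dotProduct] at this
  · intro h y hy
    obtain ⟨u, hu, rfl⟩ := Submodule.mem_map.1 hy
    rw [LinearMap.restrictScalars_apply, Matrix.toLin'_apply, pairing_mulVec_left, pairing_eq_dotProduct]
    exact (forall_v_dotProduct_le_one_iff σ hvσ _).2 h u hu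

/-- **The dual of `latt g` is `latt (g · G⁻¹)`**, `G = formCongr σ g H` the Gram matrix (`H` invertible). [cite: Jacobowitz1962, §4] [cite: Serre1980Trees, II.1.1] -/
theorem dualLatt_latt (σ : K →+* K) (hvσ : ∀ a, Valued.v (σ a) = Valued.v a) {H : Matrix (Fin N) (Fin N) K} (hH : IsUnit H.det) (g : GL (Fin N) K) :
    dualLatt σ H (latt (g : Matrix (Fin N) (Fin N) K)) = latt ((g : Matrix (Fin N) (Fin N) K) * (formCongr σ g H)⁻¹) := by
  rw [dualLatt_latt_eq σ hvσ hH (Matrix.isUnits_det_units g), inv_transpose_map_mul_eq σ H (Matrix.isUnits_det_units g)]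

end Literature.NumberTheory.Automorphic.UnitaryLatticeTree

end
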